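import Mathlib.Topology.Algebra.Module.Spaces.PointwiseConvergenceCLM
import Mathlib.MeasureTheory.Constructions.BorelSpace.Basic
import Literature.Analysis.FunctionSpaces.NuclearSpace
import Literature.MathematicalPhysics.QuantumLattice.RandomField
import HarnessLib

-- provenance: harness21/H21/H21/Prelude/AnalysisL/Minlos.lean @ 245c8a4 (interim HEAD d8f2665); M5 mechanical rewrite
/-!
# The Minlos–Sazonov theorem

Trunk **T-AQFT** (G28 AnalysisL, Part A, item P2), notions `nuclear_space_minlos`,
`random_distribution_law`.

For a real topological vector space `V` we consider its weak-* dual `V →Lₚₜ[ℝ] ℝ` (Mathlib's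
`PointwiseConvergenceCLM`) with

* the *cylinder σ-algebra* `Literature.dualCylinderSigma V`, generated by the evaluations `ω ↦ ω f`
  (a `@[reducible] def`, not an instance), the comparison `dualCylinderSigma_le_borel` (real
  proof) and its sorried converse `borel_eq_dualCylinderSigma` for separable Fréchet nuclear `V`;
* the generating functional `Literature.genFunctionalOf μ f = ∫ exp (i ω(f)) dμ(ω)` of a measure on the
  dual and the predicate `Literature.IsCharacteristicFunctionalOn C` (`C 0 = 1`, continuous, positive
  definite), with `rfl` bridges to the accepted Schwartz-space vocabulary of
  `Literature.Prelude.QLatticeAQFT.RandomField` (`AQFT.genFunctional`, `AQFT.IsCharacteristicFunctional`);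
* **Minlos' theorem** `Literature.Analysis.FunctionSpaces.minlos` on the cylinder σ-algebra of the dual of a nuclear space, its
  converse `isCharacteristicFunctionalOn_genFunctionalOf` (for first countable `V`), the uniqueness statement
  `ext_of_genFunctionalOf`, the Borel form `minlos_borel` for separable Fréchet nuclear `V`, and the
  Schwartz-space specialisation `Literature.Analysis.FunctionSpaces.schwartz_minlos`, *derived* from `minlos_borel` and the
  (sorried) theorems `nuclearSpace_schwartzMap`, `separableSpace_schwartzMap` of the NuclearSpace
  prelude.

## Sources

* R. A. Minlos, *Generalized random processes and their extension to a measure*, Trudy Moskov.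
  Mat. Obšč. 8 (1959), 497–518.
* V. Sazonov, *A remark on characteristic functionals*, Teor. Veroyatn. Primen. 3 (1958).
* I. M. Gel'fand, N. Ya. Vilenkin, *Generalized Functions IV* (1964), Ch. IV §2 Thm 2, §3, §4.2
  Thm 2 (Minlos' theorem), Ch. IV §4 (measures on duals of nuclear spaces).
* X. Fernique, *Processus linéaires, processus généralisés*, Ann. Inst. Fourier 17 (1967), 1–92
  (duals of separable Fréchet nuclear spaces are Lusin; cylinder = Borel σ-algebra).
* J. Glimm, A. Jaffe, *Quantum Physics* (2nd ed. 1987), §6.1, Thm A.6.1.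

## Mathlib

Used: `PointwiseConvergenceCLM` (`V →Lₚₜ[ℝ] ℝ`, `continuous_eval_const`), `MeasurableSpace.comap`,
`borel`, `iSup` of σ-algebras, `measurable_iff_comap_le`, Bochner integral. Verified absent at the
pin (`rg -i minlos|sazonov|cylinder.*sigma`): Minlos' theorem, cylinder σ-algebras on duals, any
`MeasurableSpace` instance on `PointwiseConvergenceCLM` (the accepted G13 instance on
`AQFT.FieldConfig E` is `borel _`, which is why the bridges below are `rfl`).

## Design

* No global `MeasurableSpace` instance on `V →Lₚₜ[ℝ] ℝ` is registered (outline §0): `minlos` is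
  stated with the explicit σ-algebra `dualCylinderSigma V` (always the correct one), while the Borel
  statements take `[MeasurableSpace (V →Lₚₜ[ℝ] ℝ)] [BorelSpace _]` as hypotheses (Mathlib idiom) and
  additionally assume `V` separable and first countable (with nuclearity: separable Fréchet
  nuclear), under which Borel = cylinder (`borel_eq_dualCylinderSigma`). No claim is made about
  Borel sets for non-metrisable nuclear `V`.
* `genFunctionalOf` takes the σ-algebra as an implicit `{m : MeasurableSpace _}` so that it applies
  both to `dualCylinderSigma V` and to Borel instances; on `V = 𝓢(E, ℝ)` it is definitionally
  `AQFT.genFunctional`.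
-/

open scoped SchwartzMap ComplexConjugate NNReal
open MeasureTheory Filter Topology Complex TopologicalSpace

namespace Literature.Analysis.FunctionSpaces

variable (V : Type*) [AddCommGroup V] [Module ℝ V] [TopologicalSpace V]

/-! ### The cylinder σ-algebra on the weak-* dual -/

/-- The *cylinder σ-algebra* on the weak-* dual `V →Lₚₜ[ℝ] ℝ`: the smallest σ-algebra making every
evaluation `ω ↦ ω f`, `f : V`, measurable. Gel'fand–Vilenkin IV, Ch. IV §1.1 (cylinder sets);
Glimm–Jaffe §6.1. A reducible definition, deliberately not an instance. [folklore] -/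
@[reducible]
noncomputable def dualCylinderSigma : MeasurableSpace (V →Lₚₜ[ℝ] ℝ) :=
  ⨆ f : V, (borel ℝ).comap fun ω => ω f

variable {V}

/-- Every evaluation `ω ↦ ω f` is measurable for the cylinder σ-algebra (by definition).
Gel'fand–Vilenkin IV, Ch. IV §1.1. [folklore] -/
theorem measurable_eval_dualCylinderSigma (f : V) :
    Measurable[dualCylinderSigma V] fun ω : V →Lₚₜ[ℝ] ℝ => ω f := by
  rw [measurable_iff_comap_le]
  exact le_iSup (fun f : V => (borel ℝ).comap fun ω : V →Lₚₜ[ℝ] ℝ => ω f) f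

variable (V) in
/-- The cylinder σ-algebra is contained in the Borel σ-algebra of the weak-* topology, since
every evaluation is weak-* continuous. Gel'fand–Vilenkin IV, Ch. IV §1.2. [folklore] -/
theorem dualCylinderSigma_le_borel : dualCylinderSigma V ≤ borel (V →Lₚₜ[ℝ] ℝ) := by
  refine iSup_le fun f => ?_
  rw [← measurable_iff_comap_le]
  borelize (V →Lₚₜ[ℝ] ℝ)
  exact (continuous_eval_const f).measurable

variable (V) in
/-- The cylinder σ-algebra is the pullback of Mathlib's product σ-algebra `MeasurableSpace.pi` on
`V → ℝ` along the coercion `ω ↦ ⇑ω`; this connects `dualCylinderSigma` to Mathlib's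
`MeasureTheory.cylinderEvents` / product-σ-algebra API. Gel'fand–Vilenkin IV, Ch. IV §1.1. [folklore] -/
theorem dualCylinderSigma_eq_comap_pi :
    dualCylinderSigma V =
      (MeasurableSpace.pi : MeasurableSpace (V → ℝ)).comap fun ω : V →Lₚₜ[ℝ] ℝ => (⇑ω : V → ℝ) := by
  simp only [dualCylinderSigma, MeasurableSpace.pi, MeasurableSpace.comap_iSup,
    MeasurableSpace.comap_comp]
  rfl

variable [IsTopologicalAddGroup V] [ContinuousSMul ℝ V]

variable (V) in
-- Binder repair (2026-08-16): the header instance deliberately shadows the section's, which a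
-- `def` does not capture (it ranged too widely before); the overlapping-instances linter is moot.
set_option linter.overlappingInstances false in
/-- **Cylinder = Borel** for the dual of a separable Fréchet nuclear space: if `V` is nuclear,
locally convex, metrisable (first countable) and separable, then the weak-* dual `V'` is a Lusin
space whose Borel σ-algebra is generated by the evaluations. Fernique 1967, Ch. III;
Gel'fand–Vilenkin IV, Ch. IV §4; for `V = 𝒮(ℝᵈ)` Glimm–Jaffe §6.1. Nuclearity and local
convexity are mathematically superfluous here (separable + first countable already suffices, `V'`
being a countable union of weak-* compact metrisable polars); they are assumed only to match the
hypotheses of `minlos_borel`. Known theorem; proof deferred. [cite: Fernique1967, Ch. III]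
(Binder repair 2026-08-16: `[IsTopologicalAddGroup V]` is written in the header so that it is a
parameter of the elaborated constant; as a section instance unused by the body it was silently
dropped, so the fact ranged over cases the printed theorem excludes.) -/
def borel_eq_dualCylinderSigma [IsTopologicalAddGroup V] : Prop :=
  ∀ [LocallyConvexSpace ℝ V] [NuclearSpace ℝ V] [FirstCountableTopology V] [SeparableSpace V],
    borel (V →Lₚₜ[ℝ] ℝ) = dualCylinderSigma V

/-! ### Generating functionals and characteristic functionals -/

/-- The *generating functional* (characteristic functional, Fourier transform) of a measure `μ`
on the weak-* dual: `f ↦ ∫ exp (i ω(f)) dμ(ω)`. The σ-algebra is an implicit argument so that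
both the cylinder σ-algebra and Borel instances apply. Gel'fand–Vilenkin IV, Ch. IV §4.1;
Glimm–Jaffe §6.1. Bochner integral: the integrand has norm `1`, so the value is a genuine
integral whenever `μ` is finite and the evaluation `ω ↦ ω f` is measurable (e.g. for any
σ-algebra containing `dualCylinderSigma V`); otherwise it is the junk value `0`. [folklore] -/
noncomputable def genFunctionalOf {m : MeasurableSpace (V →Lₚₜ[ℝ] ℝ)}
    (μ : Measure (V →Lₚₜ[ℝ] ℝ)) (f : V) : ℂ :=
  ∫ ω, cexp (I * ((ω f : ℝ) : ℂ)) ∂μ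

/-- A *characteristic functional* on `V`: `C 0 = 1`, `C` is continuous and positive definite
(`Literature.Analysis.FunctionSpaces.IsPositiveDefinite`). Gel'fand–Vilenkin IV, Ch. IV §4.1; these are the hypotheses of
Minlos' theorem. [folklore] -/
def IsCharacteristicFunctionalOn (C : V → ℂ) : Prop :=
  C 0 = 1 ∧ Continuous C ∧ IsPositiveDefinite C

/-! ### Minlos' theorem -/

variable (V) in
/-- **Minlos' theorem** (Minlos–Sazonov). Let `V` be a nuclear locally convex space and
`C : V → ℂ` a characteristic functional (continuous, positive definite, `C 0 = 1`). Then there is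
a unique probability measure `μ` on the cylinder σ-algebra of the dual `V'` with
`C f = ∫ exp (i ω(f)) dμ(ω)` for all `f`. Minlos, Trudy MMO 8 (1959); Gel'fand–Vilenkin IV,
Ch. IV §4.2 Thm 2 (existence), §4.1 (uniqueness on cylinder sets). Known theorem; proof deferred
(absent from Mathlib at the pin). [cite: GelfandVilenkinIV1964, Ch. IV §4.2 Thm. 2 (existence) and §4.1 (uniqueness)] [cite: Minlos1959] -/
def minlos : Prop :=
  ∀ [LocallyConvexSpace ℝ V] [NuclearSpace ℝ V] (C : V → ℂ) (hC : IsCharacteristicFunctionalOn C),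
    ∃! μ : @Measure (V →Lₚₜ[ℝ] ℝ) (dualCylinderSigma V),
      @IsProbabilityMeasure _ (dualCylinderSigma V) μ ∧ ∀ f, genFunctionalOf μ f = C f

/-- The converse of Minlos' theorem for first countable (e.g. metrisable, countably-normed) `V`:
the generating functional of a probability measure on the dual (for any σ-algebra making the
evaluations measurable, in particular the cylinder or the Borel one) is a characteristic
functional — normalised; continuous because `V` is first countable: sequential continuity by
dominated convergence (`continuous_iff_seqContinuous`); and positive definite since
`∑ᵢⱼ conj cᵢ cⱼ S(fⱼ - fᵢ) = ∫ |∑ⱼ cⱼ e^{iω(fⱼ)}|² dμ`. First countability cannot be dropped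
(for `V` an infinite-dimensional Hilbert space with its weak topology and `μ` a Gaussian with
infinite-rank covariance, `genFunctionalOf μ` is not weakly continuous). Gel'fand–Vilenkin IV,
Ch. IV §4.1 (countably-normed spaces); the `𝓢`-case is the accepted
`AQFT.isCharacteristicFunctional_genFunctional`. [cite: GelfandVilenkinIV1964, Ch. IV §4.1] -/
def isCharacteristicFunctionalOn_genFunctionalOf : Prop :=
  ∀ [FirstCountableTopology V] {m : MeasurableSpace (V →Lₚₜ[ℝ] ℝ)} (hm : dualCylinderSigma V ≤ m) (μ : Measure (V →Lₚₜ[ℝ] ℝ)) [IsProbabilityMeasure μ],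
    IsCharacteristicFunctionalOn (genFunctionalOf μ)

-- Binder repair (2026-08-16): the header instance deliberately shadows the section's, which a
-- `def` does not capture (it ranged too widely before); the overlapping-instances linter is moot.
set_option linter.overlappingInstances false in
/-- **Uniqueness in Minlos' theorem, Borel form.** On the dual of a separable Fréchet nuclear
space (where Borel = cylinder, `borel_eq_dualCylinderSigma`), two finite Borel measures with the
same generating functional coincide. Gel'fand–Vilenkin IV, Ch. IV §4.1; generic form of the
accepted `AQFT.ext_of_genFunctional` (RandomField), which is the case `V = 𝓢(E, ℝ)`;
cf. Mathlib `MeasureTheory.Measure.ext_of_charFunDual` for normed spaces. As in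
`borel_eq_dualCylinderSigma`, nuclearity and local convexity are not needed mathematically and are
assumed only to match `minlos_borel`. Proof deferred. [cite: GelfandVilenkinIV1964, Ch. IV §4.1]
(Binder repair 2026-08-16: `[IsTopologicalAddGroup V]` is written in the header so that it is a
parameter of the elaborated constant; as a section instance unused by the body it was silently
dropped, so the fact ranged over cases the printed theorem excludes.) -/
def ext_of_genFunctionalOf [IsTopologicalAddGroup V] : Prop :=
  ∀ [MeasurableSpace (V →Lₚₜ[ℝ] ℝ)] [BorelSpace (V →Lₚₜ[ℝ] ℝ)] [LocallyConvexSpace ℝ V] [NuclearSpace ℝ V] [FirstCountableTopology V] [SeparableSpace V] {μ ν : Measure (V →Lₚₜ[ℝ] ℝ)} [IsFiniteMeasure μ] [IsFiniteMeasure ν] (h : genFunctionalOf μ = genFunctionalOf ν),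
    μ = ν

variable (V) in
-- Binder repair (2026-08-16): the header instance deliberately shadows the section's, which a
-- `def` does not capture (it ranged too widely before); the overlapping-instances linter is moot.
set_option linter.overlappingInstances false in
/-- **Minlos' theorem, Borel form.** For a separable Fréchet nuclear space `V` (nuclear, locally
convex, first countable, separable) every characteristic functional `C` is the generating
functional of a unique Borel probability measure on the weak-* dual `V'`. From `minlos` and
`borel_eq_dualCylinderSigma`; Gel'fand–Vilenkin IV, Ch. IV §4.2 Thm 2 with Fernique 1967. The
uniqueness half specialises to the accepted `AQFT.ext_of_genFunctional`. Proof deferred. [cite: Fernique1967, The uniqueness half specialises to the a]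
(Binder repair 2026-08-16: `[IsTopologicalAddGroup V]` is written in the header so that it is a
parameter of the elaborated constant; as a section instance unused by the body it was silently
dropped, so the fact ranged over cases the printed theorem excludes.) -/
def minlos_borel [IsTopologicalAddGroup V] : Prop :=
  ∀ [MeasurableSpace (V →Lₚₜ[ℝ] ℝ)] [BorelSpace (V →Lₚₜ[ℝ] ℝ)] [LocallyConvexSpace ℝ V] [NuclearSpace ℝ V] [FirstCountableTopology V] [SeparableSpace V] (C : V → ℂ) (hC : IsCharacteristicFunctionalOn C),
    ∃! μ : Measure (V →Lₚₜ[ℝ] ℝ), IsProbabilityMeasure μ ∧ ∀ f, genFunctionalOf μ f = C f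

end Literature.Analysis.FunctionSpaces

/-! ### Bridges to the accepted Schwartz-space vocabulary -/

namespace Literature.Analysis.FunctionSpaces

variable {E : Type*} [NormedAddCommGroup E] [NormedSpace ℝ E]

/-- On `V = 𝓢(E, ℝ)` (so that `V →Lₚₜ[ℝ] ℝ = FieldConfig E` with its Borel instance) the generic
generating functional is definitionally the accepted `AQFT.genFunctional` (RandomField;
Glimm–Jaffe §6.1). [folklore] -/
@[simp]
theorem genFunctionalOf_eq_genFunctional (μ : Measure (Literature.MathematicalPhysics.QuantumLattice.FieldConfig E)) (f : 𝓢(E, ℝ)) :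
    genFunctionalOf μ f = Literature.MathematicalPhysics.QuantumLattice.genFunctional μ f :=
  rfl

/-- The accepted `AQFT.IsCharacteristicFunctional` (RandomField; Gel'fand–Vilenkin IV §3) is
literally the case `V = 𝓢(E, ℝ)` of `Literature.Analysis.FunctionSpaces.IsCharacteristicFunctionalOn` (via
`AQFT.isPositiveDefiniteFunctional_iff`). [folklore] -/
theorem isCharacteristicFunctional_iff (C : 𝓢(E, ℝ) → ℂ) :
    Literature.MathematicalPhysics.QuantumLattice.IsCharacteristicFunctional C ↔ IsCharacteristicFunctionalOn C :=
  Iff.rfl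

/-- **Minlos' theorem for Schwartz space**: for finite-dimensional `E`, every characteristic
functional on `𝓢(E, ℝ)` is the generating functional of a unique Borel probability measure on
`FieldConfig E = 𝒮'(E)`. This is the prelude form of the accepted (sorried)
`ConstructiveQFT.bochner_minlos` (Statements/ConstructiveQFT/OSAxioms), here *derived* from the
general nuclear Minlos theorem `minlos_borel` together with `nuclearSpace_schwartzMap` and
`separableSpace_schwartzMap`; it shows that the general theorem specialises to it.
Minlos 1959; Gel'fand–Vilenkin IV, Ch. IV §4.2 Thm 2; Glimm–Jaffe Thm A.6.1. [cite: Minlos1959] -/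
def schwartz_minlos : Prop :=
  ∀ [FiniteDimensional ℝ E] (C : 𝓢(E, ℝ) → ℂ) (hC : Literature.MathematicalPhysics.QuantumLattice.IsCharacteristicFunctional C),
    ∃! μ : Measure (Literature.MathematicalPhysics.QuantumLattice.FieldConfig E), IsProbabilityMeasure μ ∧ ∀ f, Literature.MathematicalPhysics.QuantumLattice.genFunctional μ f = C f

/- interim proof relied on results that are now named facts (D-0014); demoted to a fact by the M5 import, proof preserved:
:= by
  haveI : NuclearSpace ℝ 𝓢(E, ℝ) := nuclearSpace_schwartzMap E ℝ
  haveI : SeparableSpace 𝓢(E, ℝ) := separableSpace_schwartzMap E ℝ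
  simpa using minlos_borel 𝓢(E, ℝ) C ((isCharacteristicFunctional_iff C).1 hC)
-/

end Literature.Analysis.FunctionSpaces
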